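import Mathlib
import Summits.AtomisticToContinuum.FouriersLaw.Theses.ParityLiouvilleSeed
import Summits.AtomisticToContinuum.FouriersLaw.Theorems.ParityLiouvilleSeedCesaroUpgrade
import HarnessLib

/-!
# `LiouvilleForHeat` is equivalent to its shift-invariant case

Support file (`--supports stmt-AtomisticToContinuum-13980`, route `ParityLiouvilleSeed`, decl
`Summit.AtomisticToContinuum.FouriersLaw.Theses.ParityLiouvilleSeed.LiouvilleForHeat`).

`LiouvilleForHeat` (no shift invariance assumed; translation-bounded moments; uniform regularity
w.r.t. a SHIFT-INVARIANT Gibbs state) follows from the proved glue `CesaroUpgrade` applied to the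
crux `ZeroCurrentRigidity`. The Cesàro argument (`cesaroUpgrade_proof`) in fact only ever applies
zero-current rigidity to a limit state which is shift invariant AND translation bounded AND
uniformly regular w.r.t. the SAME shift-invariant reference. Recording this gives the exact
position of the item:

* `liouvilleForHeat_of_shiftInvariant_case` — **W.L.O.G. `ν` is shift invariant**: the restriction
  of `LiouvilleForHeat` to shift-invariant states already implies `LiouvilleForHeat` (same proof as
  `cesaroUpgrade_proof`, keeping the moments and the shift-invariant reference of the limit);
* `liouvilleForHeat_iff_shiftInvariant_case` — hence `LiouvilleForHeat` is EQUIVALENT to its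
  shift-invariant case;
* `shiftInvariant_case_of_zeroCurrentRigidity` — and that case is the sub-statement of
  `ZeroCurrentRigidity` (stmt-AtomisticToContinuum-12073) obtained by adding translation-bounded
  moments and asking the regularity reference to be shift invariant.

So the open content of item 13980 is precisely "`ZeroCurrentRigidity` for translation-bounded
states, regular w.r.t. the shift-invariant thermal state" — the odd sector of macro-ergodicity in
Bernardin's own setting (Bernardin 2014, Def. 1: regularity w.r.t. the grand-canonical, i.e.
translation-invariant, reference). Nothing here closes the item. [folklore]
-/

noncomputable section

namespace Summit.AtomisticToContinuum.FouriersLaw.Theorems.ParityLiouvilleSeed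

open MeasureTheory Filter Topology Set BoundedContinuousFunction InformationTheory
open scoped ENNReal
open Literature.MathematicalPhysics.KineticTheory.HeatConduction
open Summit.AtomisticToContinuum.FouriersLaw.Theorems.CesaroUpgrade

/-- **`LiouvilleForHeat` from its shift-invariant case** (Cesàro averaging over translations,
Prokhorov compactness, l.s.c. of the relative entropy, bond independence of the mean current — the
proof of `cesaroUpgrade_proof`, whose limit state keeps the translation-bounded moments and the
shift-invariant reference). [folklore] -/
theorem liouvilleForHeat_of_shiftInvariant_case
    (hZ : ∀ ω₂ lam β γ : ℝ, 0 < ω₂ → 0 < lam → 0 < β →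
      ∀ ν : Measure ChainConfig, IsProbabilityMeasure ν → IsShiftInvariant ν →
        IsTimeInvariant (pinnedChain ω₂ lam β γ) ν →
        (∀ m : ℕ, ∃ C : ℝ, ∀ x : ℤ,
          Integrable (fun σ : ChainConfig => |(σ x).1| ^ m + |(σ x).2| ^ m) ν ∧
            ∫ σ, (|(σ x).1| ^ m + |(σ x).2| ^ m) ∂ν ≤ C) →
        (∃ (T : ℝ) (μT : Measure ChainConfig), 0 < T ∧
          (pinnedChain ω₂ lam β γ).IsChainGibbsMeasure T μT ∧ IsShiftInvariant μT ∧
            ∃ C : ENNReal, C ≠ ⊤ ∧ ∀ (a : ℤ) (n : ℕ),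
              klDiv (boxMarginal a n ν) (boxMarginal a n μT) ≤ C * (n + 1)) →
        Integrable (fun σ => (pinnedChain ω₂ lam β γ).bondCurrentZ σ 0) ν →
        ∫ σ, (pinnedChain ω₂ lam β γ).bondCurrentZ σ 0 ∂ν = 0) :
    Summit.AtomisticToContinuum.FouriersLaw.Theses.ParityLiouvilleSeed.LiouvilleForHeat := by
  intro ω₂ lam β γ hω hl hβ ν hprob hTI hMom hReg hInt
  obtain ⟨T, μT, hT, hGibbs, hSI, C, hCtop, hCreg⟩ := hReg
  haveI : IsProbabilityMeasure μT := hGibbs.isProbabilityMeasure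
  choose Cm hCm using hMom
  -- Cesàro averages and a shift-invariant cluster point
  obtain ⟨c, ν', U, hc, hU, hlim, hshift⟩ := exists_cesaro_clusterPt ν (hCm 2)
  have hcTI : ∀ N, IsTimeInvariant (pinnedChain ω₂ lam β γ) (c N : Measure ChainConfig) := fun N => by
    rw [hc N]; exact isTimeInvariant_cesaro hTI N
  have hcmom : ∀ (m N : ℕ) (x : ℤ),
      Integrable (fun σ : ChainConfig => |(σ x).1| ^ m + |(σ x).2| ^ m) (c N : Measure ChainConfig) ∧
        ∫ σ, (|(σ x).1| ^ m + |(σ x).2| ^ m) ∂(c N : Measure ChainConfig) ≤ Cm m := fun m N x => by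
    rw [hc N]; exact site_moment_cesaro (hCm m) N x
  -- (1) moments of the limit
  have hmom' : ∀ m : ℕ, ∃ C : ℝ, ∀ x : ℤ,
      Integrable (fun σ : ChainConfig => |(σ x).1| ^ m + |(σ x).2| ^ m) (ν' : Measure ChainConfig) ∧
        ∫ σ, (|(σ x).1| ^ m + |(σ x).2| ^ m) ∂(ν' : Measure ChainConfig) ≤ C := fun m =>
    ⟨Cm m, fun x => integrable_of_tendsto_of_integral_le hlim
      (g := fun σ : ChainConfig => |(σ x).1| ^ m + |(σ x).2| ^ m) (by fun_prop)
      (fun σ => by positivity) fun N => hcmom m N x⟩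
  -- (2) time invariance of the limit
  have hTI' : IsTimeInvariant (pinnedChain ω₂ lam β γ) (ν' : Measure ChainConfig) := by
    intro f hf
    obtain ⟨R, K, -, hle⟩ := exists_abs_liouvilleZ_le_growth ω₂ lam β γ hf
    have hcont := continuous_liouvilleZ_of_isLocalTestFunction ω₂ lam β γ hf
    have hsq := fun N => sq_integral_le_of_growth (d := 3) hle hcont.aestronglyMeasurable (hcmom 6 N)
    obtain ⟨hint', -, -, hconv⟩ := tendsto_integral_of_tendsto_of_sq_le hlim hcont hsq
    refine ⟨hint', ?_⟩
    have h0 : (fun N => ∫ σ, liouvilleZ (pinnedChain ω₂ lam β γ) f σ ∂(c N : Measure ChainConfig)) =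
        fun _ => 0 := funext fun N => ((hcTI N) f hf).2
    rw [h0] at hconv
    exact (tendsto_nhds_unique tendsto_const_nhds hconv).symm
  -- (3) regularity of the limit, w.r.t. the SAME shift-invariant reference
  have hReg' : ∀ (a : ℤ) (n : ℕ),
      klDiv (boxMarginal a n (ν' : Measure ChainConfig)) (boxMarginal a n μT) ≤ C * (n + 1) := by
    intro a n
    have hbox : Continuous (boxRestrictAt a n) := continuous_boxRestrictAt a n
    have hlim_box := ProbabilityMeasure.tendsto_map_of_tendsto_of_continuous c ν' hlim hbox
    have hCn : C * (n + 1) ≠ ⊤ := ENNReal.mul_ne_top hCtop (by simp)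
    have key := klDiv_le_of_tendsto hlim_box (boxMarginal a n μT) (r := (C * (n + 1)).toReal)
      fun N φ => by
        rw [ProbabilityMeasure.toMeasure_map, hc N]
        exact cesaro_box_dv_le hSI hCtop hCreg N a n φ
    rw [ProbabilityMeasure.toMeasure_map, ENNReal.ofReal_toReal hCn] at key
    exact key
  -- (4) the current
  have hj : ∀ σ, |(pinnedChain ω₂ lam β γ).bondCurrentZ σ 0| ≤ (2 + 8 * |β|) * (1 + ‖boxRestrict 1 σ‖) ^ 4 :=
    fun σ => abs_pinnedChain_bondCurrentZ_le ω₂ lam β γ (R := 1) (x := 0) (by simp) σ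
  have hjcont := continuous_pinnedChain_bondCurrentZ ω₂ lam β γ 0
  have hsq0 := fun N => sq_integral_le_of_growth (d := 4) hj hjcont.aestronglyMeasurable (hcmom 8 N)
  obtain ⟨hint0, -, -, hconv0⟩ := tendsto_integral_of_tendsto_of_sq_le hlim hjcont hsq0
  have hmomν : ∀ m : ℕ, ∃ C : ℝ, ∀ x : ℤ,
      Integrable (fun σ : ChainConfig => |(σ x).1| ^ m + |(σ x).2| ^ m) ν ∧
        ∫ σ, (|(σ x).1| ^ m + |(σ x).2| ^ m) ∂ν ≤ C := fun m => ⟨Cm m, hCm m⟩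
  have hcI : ∀ N, ∫ σ, (pinnedChain ω₂ lam β γ).bondCurrentZ σ 0 ∂(c N : Measure ChainConfig) =
      ∫ σ, (pinnedChain ω₂ lam β γ).bondCurrentZ σ 0 ∂ν := by
    intro N
    rw [hc N]
    refine integral_cesaro_eq_of_forall_eq N hjcont.measurable (fun k => ?_)
      (integral_bondCurrentZ_comp_shift_iterate ω₂ lam β γ hTI hmomν)
    have hk : ∀ σ, |((fun σ => (pinnedChain ω₂ lam β γ).bondCurrentZ σ 0) ∘ shift^[k]) σ| ≤
        (2 + 8 * |β|) * (1 + ‖boxRestrict (k + 1) σ‖) ^ 4 := fun σ => by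
      simp only [Function.comp_apply, bondCurrentZ_shift_iterate, zero_add]
      exact abs_pinnedChain_bondCurrentZ_le ω₂ lam β γ (R := k + 1) (x := k) (by simp) σ
    exact (integrable_of_abs_le_growth hk
      ((hjcont.comp (continuous_shift_iterate k)).aestronglyMeasurable) (hCm 4)).1
  have hconst : (fun N => ∫ σ, (pinnedChain ω₂ lam β γ).bondCurrentZ σ 0 ∂(c N : Measure ChainConfig)) =
      fun _ => ∫ σ, (pinnedChain ω₂ lam β γ).bondCurrentZ σ 0 ∂ν := funext hcI
  rw [hconst] at hconv0
  have heq : ∫ σ, (pinnedChain ω₂ lam β γ).bondCurrentZ σ 0 ∂ν =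
      ∫ σ, (pinnedChain ω₂ lam β γ).bondCurrentZ σ 0 ∂(ν' : Measure ChainConfig) :=
    tendsto_nhds_unique tendsto_const_nhds hconv0
  -- (5) the shift-invariant case, applied to the limit
  rw [heq]
  exact hZ ω₂ lam β γ hω hl hβ ν' ν'.prop hshift hTI' hmom' ⟨T, μT, hT, hGibbs, hSI, C, hCtop, hReg'⟩ hint0

/-- **`LiouvilleForHeat` is equivalent to its shift-invariant case.** [folklore] -/
theorem liouvilleForHeat_iff_shiftInvariant_case :
    Summit.AtomisticToContinuum.FouriersLaw.Theses.ParityLiouvilleSeed.LiouvilleForHeat ↔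
      ∀ ω₂ lam β γ : ℝ, 0 < ω₂ → 0 < lam → 0 < β →
        ∀ ν : Measure ChainConfig, IsProbabilityMeasure ν → IsShiftInvariant ν →
          IsTimeInvariant (pinnedChain ω₂ lam β γ) ν →
          (∀ m : ℕ, ∃ C : ℝ, ∀ x : ℤ,
            Integrable (fun σ : ChainConfig => |(σ x).1| ^ m + |(σ x).2| ^ m) ν ∧
              ∫ σ, (|(σ x).1| ^ m + |(σ x).2| ^ m) ∂ν ≤ C) →
          (∃ (T : ℝ) (μT : Measure ChainConfig), 0 < T ∧
            (pinnedChain ω₂ lam β γ).IsChainGibbsMeasure T μT ∧ IsShiftInvariant μT ∧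
              ∃ C : ENNReal, C ≠ ⊤ ∧ ∀ (a : ℤ) (n : ℕ),
                klDiv (boxMarginal a n ν) (boxMarginal a n μT) ≤ C * (n + 1)) →
          Integrable (fun σ => (pinnedChain ω₂ lam β γ).bondCurrentZ σ 0) ν →
          ∫ σ, (pinnedChain ω₂ lam β γ).bondCurrentZ σ 0 ∂ν = 0 :=
  ⟨fun h ω₂ lam β γ hω hl hβ ν hprob _ hTI hMom hReg hInt =>
    h ω₂ lam β γ hω hl hβ ν hprob hTI hMom hReg hInt,
    liouvilleForHeat_of_shiftInvariant_case⟩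

/-- **The shift-invariant case of `LiouvilleForHeat` is a sub-statement of `ZeroCurrentRigidity`**
(forget the moments; a shift-invariant reference is in particular a reference). [folklore] -/
theorem shiftInvariant_case_of_zeroCurrentRigidity
    (hZ : Summit.AtomisticToContinuum.FouriersLaw.Theses.ParityLiouvilleSeed.ZeroCurrentRigidity) :
    ∀ ω₂ lam β γ : ℝ, 0 < ω₂ → 0 < lam → 0 < β →
      ∀ ν : Measure ChainConfig, IsProbabilityMeasure ν → IsShiftInvariant ν →
        IsTimeInvariant (pinnedChain ω₂ lam β γ) ν →
        (∀ m : ℕ, ∃ C : ℝ, ∀ x : ℤ,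
          Integrable (fun σ : ChainConfig => |(σ x).1| ^ m + |(σ x).2| ^ m) ν ∧
            ∫ σ, (|(σ x).1| ^ m + |(σ x).2| ^ m) ∂ν ≤ C) →
        (∃ (T : ℝ) (μT : Measure ChainConfig), 0 < T ∧
          (pinnedChain ω₂ lam β γ).IsChainGibbsMeasure T μT ∧ IsShiftInvariant μT ∧
            ∃ C : ENNReal, C ≠ ⊤ ∧ ∀ (a : ℤ) (n : ℕ),
              klDiv (boxMarginal a n ν) (boxMarginal a n μT) ≤ C * (n + 1)) →
        Integrable (fun σ => (pinnedChain ω₂ lam β γ).bondCurrentZ σ 0) ν →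
        ∫ σ, (pinnedChain ω₂ lam β γ).bondCurrentZ σ 0 ∂ν = 0 := by
  intro ω₂ lam β γ hω hl hβ ν hprob hS hTI _ hReg hInt
  obtain ⟨T, μT, hT, hGibbs, -, C, hCtop, hCreg⟩ := hReg
  exact hZ ω₂ lam β γ hω hl hβ ν hprob hS hTI ⟨T, μT, hT, hGibbs, C, hCtop, hCreg⟩ hInt

end Summit.AtomisticToContinuum.FouriersLaw.Theorems.ParityLiouvilleSeed

end
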